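import Mathlib

/-!
# Route `KPlusLogSqLaw`, crux `TropicalB` — Toeplitz sector: THE STRING LAW of the parameter-free pencil
# (every maximiser of `Σ_b (K|σ b − b| − c(σ b − b)²)` is the ranking permutation of its own sign keys; optimal permutations
# are window-count rankings of `±1`-strings)

HONEST FRAMING.  Helper toward the registered stubs `stub_tropThin` / `stub_tropFat` of `Cruxes/TropicalB/Lines/birth.lean` (crux
`Summit.ValiantsHypothesis.ValiantsHypothesis.Theses.KPlusLogSqLaw.TropicalB`, ledger item `stmt-ValiantsHypothesis-19771`, route `KPlusLogSqLaw`;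
cell `pub-symmetroid`, seat `val-sym-trop-p4` (g24), 2026-08-29; `--supports … --as helper`).  STRUCTURE THEOREM behind this seat's MORPH THEOREM
(`…ToeplitzMorphMember`, g23) and doubling laws (`…ToeplitzDoublingMorph`, `…ToeplitzSuperlinear`): the memo HOME/val-sym-trop-p4/g23/MORPH-THEOREM-g23.md
§1 «string reformulation», typed for ALL sizes `m`, all `K ≥ 0` and all `c` (the pencil of record is `c = 2`, `K = 4q + 2j + 1` odd).  Nothing here
bounds `Φ_Toep` from above; `ConjectureTPoly`, `TropicalB` (for Toeplitz or general designs), `WeakLifting`, `KPlusLogSqLaw`, `MatrixDescartes`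
(stmt-ValiantsHypothesis-18050) and `VP ≠ VNP` are untouched.

THE LAW.  Fix integers `K ≥ 0`, `c`, a size `m`, and write `δ_b(σ) = σ b − b` for `σ ∈ S_m`; the PARAMETER-FREE PENCIL is
`P(σ) = Σ_b (K·|δ_b| − c·δ_b²)` (`c = 2`: `Σ_b |δ_b|(K − 2|δ_b|)`, the objective of `morph_member`).  For a sign string `ε : Fin m → {1, −1}` put
`κ_b = 2c·b + K·ε_b` (integer KEYS) and call `ρ ∈ S_m` a RANKING of `κ` if `ρ b < ρ b' ↔ κ_b < κ_{b'}`.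
* `linSum_le_pencil`, `linSum_eq_pencil_of_compatible` — LINEARISATION: `Σ_b (K ε_b δ_b − c δ_b²) ≤ P(σ)` (as `ε_b δ_b ≤ |δ_b|`), with equality when
  `ε` is compatible with `σ` (`ε_b δ_b = |δ_b|`; the sign string `ε_b = [b ≤ σ b] − [σ b < b]` always is, `signString_compatible`).
* `linSum_eq_keySum` — COMPLETING THE SQUARE: `Σ_b (K ε_b δ_b − c δ_b²) = Σ_b σ(b)·κ_b − (2c Σ_b b² + K Σ_b ε_b b)` (uses `Σ_b σ(b)² = Σ_b b²`), so for
  a fixed string the linearised pencil is the rearrangement functional `σ ↦ Σ_b σ(b) κ_b` up to a constant.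
* `exists_ranking`, `ranking_unique`, `keySum_lt_of_ne_ranking` — REARRANGEMENT (Mathlib `Monovary`): injective keys have exactly one ranking `ρ`,
  and `Σ_b σ(b) κ_b < Σ_b ρ(b) κ_b` for every `σ ≠ ρ`.
* ★ `pencil_le_pencil_selfRanking` / `pencil_lt_pencil_selfRanking` — THE STRING LAW: for EVERY `σ`, if `ρ` ranks the keys of `σ`'s own sign string then
  `P(σ) ≤ P(ρ)`, STRICTLY unless `σ = ρ`.  Hence (`selfRanking_of_isMax`) every maximiser of `P` over `S_m` is the ranking of its own sign string, a unique
  maximiser (as in `morph_member`) in particular, and `max_{S_m} P = max_ε P(ρ_ε)` over the `2^m` strings (`exists_string_ranking_ge`): the optimisation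
  over `m!` permutations is an optimisation over sign strings.
* `signKeys_injective` — the keys of a string are injective as soon as `0 < c` and `c·t ≠ K` for `0 < t < m` (automatic for `c = 2`, `K` odd:
  `signKeys_injective_two_odd`), so rankings exist (`exists_selfRanking`).
* Part 2 (`…ToeplitzStringLawWindows`): rankings are compatible with their strings and their displacements are WINDOW COUNTS
  (`#{−1's at b' > b, c(b'−b) < K}` resp. `−#{+1's at b' < b, c(b−b') ≤ K}`; for `c = 2`, `K = 2L+1` the windows `(b, b+L]`, `[b−L, b)` of the memo —
  the morph member `μ_j` of `morph_member` is the ranking of the string `U^q D^{q−j} (UD)^j U^{q−j} D^q`, `L = 2q + j`).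

All statements are definition-free (keys, strings and rankings enter as hypotheses).  References: the rearrangement inequality (Hardy–Littlewood–Pólya,
Inequalities, Thm 368; Mathlib `Monovary.sum_mul_comp_perm_lt_sum_mul_iff`) [folklore]; the pencil and the morph family: this seat's g22/g23 files.
-/

set_option linter.dupNamespace false
set_option autoImplicit false

namespace Summit.ValiantsHypothesis.ValiantsHypothesis.Theorems.KPlusLogSqLaw.Toeplitz

open scoped BigOperators
open Finset

variable {m : ℕ}

/-! ## 1. Linearisation along a sign string and completing the square -/

/-- One term: for `ε ∈ {1, −1}` and `0 ≤ K`, `K ε δ − c δ² ≤ K|δ| − c δ²`. [folklore] -/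
theorem linTerm_le (K c ε δ : ℤ) (hK : 0 ≤ K) (hε : ε = 1 ∨ ε = -1) :
    K * ε * δ - c * δ ^ 2 ≤ K * |δ| - c * δ ^ 2 := by
  have h : ε * δ ≤ |δ| := by
    rcases hε with rfl | rfl
    · simpa using le_abs_self δ
    · simpa using neg_le_abs δ
  nlinarith

/-- **Linearisation**: for every `±1`-string `ε` and every permutation `σ`, the linearised pencil is at most the pencil,
`Σ_b (K ε_b δ_b − c δ_b²) ≤ Σ_b (K|δ_b| − c δ_b²)` (`δ_b = σ b − b`, `0 ≤ K`). [folklore] -/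
theorem linSum_le_pencil (K c : ℤ) (hK : 0 ≤ K) (ε : Fin m → ℤ) (hε : ∀ b, ε b = 1 ∨ ε b = -1)
    (σ : Equiv.Perm (Fin m)) :
    ∑ b, (K * ε b * (((σ b : Fin m) : ℤ) - b) - c * (((σ b : Fin m) : ℤ) - b) ^ 2) ≤
      ∑ b, (K * |((σ b : Fin m) : ℤ) - b| - c * (((σ b : Fin m) : ℤ) - b) ^ 2) :=
  Finset.sum_le_sum fun b _ => linTerm_le K c (ε b) _ hK (hε b)

/-- **Equality for compatible strings**: if `ε_b δ_b = |δ_b|` for every `b` then the linearised pencil IS the pencil. [folklore] -/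
theorem linSum_eq_pencil_of_compatible (K c : ℤ) (ε : Fin m → ℤ) (σ : Equiv.Perm (Fin m))
    (hcomp : ∀ b, ε b * (((σ b : Fin m) : ℤ) - b) = |((σ b : Fin m) : ℤ) - b|) :
    ∑ b, (K * ε b * (((σ b : Fin m) : ℤ) - b) - c * (((σ b : Fin m) : ℤ) - b) ^ 2) =
      ∑ b, (K * |((σ b : Fin m) : ℤ) - b| - c * (((σ b : Fin m) : ℤ) - b) ^ 2) := by
  refine Finset.sum_congr rfl fun b _ => ?_
  rw [← hcomp b]; ring

/-- The SIGN STRING of a permutation, `ε_b = 1` if `b ≤ σ b` and `−1` otherwise, is compatible with it. [folklore] -/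
theorem signString_compatible (σ : Equiv.Perm (Fin m)) (b : Fin m) :
    (if (b : ℤ) ≤ ((σ b : Fin m) : ℤ) then (1 : ℤ) else -1) * (((σ b : Fin m) : ℤ) - b) = |((σ b : Fin m) : ℤ) - b| := by
  split_ifs with h
  · rw [one_mul, abs_of_nonneg (by linarith)]
  · rw [abs_of_neg (by linarith)]; ring

/-- The sign string takes values in `{1, −1}`. [folklore] -/
theorem signString_mem (σ : Equiv.Perm (Fin m)) (b : Fin m) :
    (if (b : ℤ) ≤ ((σ b : Fin m) : ℤ) then (1 : ℤ) else -1) = 1 ∨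
      (if (b : ℤ) ≤ ((σ b : Fin m) : ℤ) then (1 : ℤ) else -1) = -1 := by
  split_ifs <;> simp

/-- **Completing the square**: `Σ_b (K ε_b δ_b − c δ_b²) = Σ_b σ(b)·(2c b + K ε_b) − (2c Σ_b b² + K Σ_b ε_b b)` — for a fixed string the
linearised pencil is the rearrangement functional of the integer KEYS `κ_b = 2c b + K ε_b`, up to a constant (because `Σ_b σ(b)² = Σ_b b²`).
[folklore] -/
theorem linSum_eq_keySum (K c : ℤ) (ε : Fin m → ℤ) (σ : Equiv.Perm (Fin m)) :
    ∑ b, (K * ε b * (((σ b : Fin m) : ℤ) - b) - c * (((σ b : Fin m) : ℤ) - b) ^ 2) =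
      ∑ b, ((σ b : Fin m) : ℤ) * (2 * c * (b : ℤ) + K * ε b) -
        (2 * c * ∑ b : Fin m, (b : ℤ) ^ 2 + K * ∑ b : Fin m, ε b * (b : ℤ)) := by
  have hsq : ∑ b, ((σ b : Fin m) : ℤ) ^ 2 = ∑ b : Fin m, (b : ℤ) ^ 2 :=
    Equiv.sum_comp σ (fun b : Fin m => (b : ℤ) ^ 2)
  have h : ∀ b : Fin m, K * ε b * (((σ b : Fin m) : ℤ) - b) - c * (((σ b : Fin m) : ℤ) - b) ^ 2 =
      (((σ b : Fin m) : ℤ) * (2 * c * (b : ℤ) + K * ε b) - K * (ε b * (b : ℤ)) - c * (b : ℤ) ^ 2) -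
        c * ((σ b : Fin m) : ℤ) ^ 2 := by
    intro b; ring
  simp_rw [h]
  rw [Finset.sum_sub_distrib, Finset.sum_sub_distrib, Finset.sum_sub_distrib, ← Finset.mul_sum, ← Finset.mul_sum,
    ← Finset.mul_sum, hsq]
  ring

/-! ## 2. Rankings of injective keys and the strict rearrangement inequality -/

/-- A ranking determines the keys' strict order, so ranked keys are injective. [folklore] -/
theorem injective_of_ranking (κ : Fin m → ℤ) (ρ : Equiv.Perm (Fin m)) (hρ : ∀ b b', ρ b < ρ b' ↔ κ b < κ b') :
    Function.Injective κ := by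
  intro b b' h
  by_contra hne
  rcases lt_or_gt_of_ne ((ρ.injective.ne_iff).mpr hne) with hlt | hlt
  · exact absurd ((hρ _ _).mp hlt) (by rw [h]; exact lt_irrefl _)
  · exact absurd ((hρ _ _).mp hlt) (by rw [h]; exact lt_irrefl _)

/-- **Injective keys have a ranking** (sort them: Mathlib `Tuple.sort`). [folklore] -/
theorem exists_ranking (κ : Fin m → ℤ) (hκ : Function.Injective κ) :
    ∃ ρ : Equiv.Perm (Fin m), ∀ b b', ρ b < ρ b' ↔ κ b < κ b' := by
  have hmono : Monotone (κ ∘ Tuple.sort κ) := Tuple.monotone_sort κ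
  have hsm : StrictMono (κ ∘ Tuple.sort κ) := hmono.strictMono_of_injective (hκ.comp (Tuple.sort κ).injective)
  refine ⟨(Tuple.sort κ).symm, fun b b' => ?_⟩
  have h := hsm.lt_iff_lt (a := (Tuple.sort κ).symm b) (b := (Tuple.sort κ).symm b')
  simp only [Function.comp, Equiv.apply_symm_apply] at h
  exact h.symm

/-- A strictly monotone self-map of `Fin m` is the identity. [folklore] -/
theorem eq_self_of_strictMono {φ : Fin m → Fin m} (hφ : StrictMono φ) (x : Fin m) : φ x = x :=
  le_antisymm (hφ.le_id x) (hφ.id_le x)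

/-- **Rankings are unique.** [folklore] -/
theorem ranking_unique (κ : Fin m → ℤ) {ρ ρ' : Equiv.Perm (Fin m)} (hρ : ∀ b b', ρ b < ρ b' ↔ κ b < κ b')
    (hρ' : ∀ b b', ρ' b < ρ' b' ↔ κ b < κ b') : ρ = ρ' := by
  have hsm : StrictMono fun x => ρ' (ρ.symm x) := by
    intro x y hxy
    have h1 : ρ (ρ.symm x) < ρ (ρ.symm y) := by simpa using hxy
    exact (hρ' _ _).mpr ((hρ _ _).mp h1)
  ext x
  have h := eq_self_of_strictMono hsm (ρ x)
  simp only [Equiv.symm_apply_apply] at h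
  rw [h]

/-- **Strict rearrangement inequality for a ranking**: if `ρ` ranks the keys `κ` then `Σ_b σ(b)·κ_b < Σ_b ρ(b)·κ_b` for every permutation
`σ ≠ ρ` (Mathlib's `Monovary.sum_mul_comp_perm_lt_sum_mul_iff` applied to `π = σ ∘ ρ⁻¹`; a monovarying competitor would make `ρ ∘ σ⁻¹` a strictly
monotone self-map of `Fin m`, i.e. the identity). [folklore: Hardy–Littlewood–Pólya, Thm 368] -/
theorem keySum_lt_of_ne_ranking (κ : Fin m → ℤ) (ρ : Equiv.Perm (Fin m)) (hρ : ∀ b b', ρ b < ρ b' ↔ κ b < κ b')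
    (σ : Equiv.Perm (Fin m)) (hσ : σ ≠ ρ) :
    ∑ b, ((σ b : Fin m) : ℤ) * κ b < ∑ b, ((ρ b : Fin m) : ℤ) * κ b := by
  have hinj := injective_of_ranking κ ρ hρ
  -- `κ` and `b ↦ ρ b` monovary
  have hmv : Monovary κ (fun b => ((ρ b : Fin m) : ℤ)) := by
    intro i j hij
    have h0 : (((ρ i : Fin m) : ℕ) : ℤ) < (((ρ j : Fin m) : ℕ) : ℤ) := hij
    have h1 : ρ i < ρ j := Fin.lt_def.mpr (by exact_mod_cast h0)
    exact ((hρ i j).mp h1).le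
  -- the competitor as `ρ ∘ π`
  set π : Equiv.Perm (Fin m) := σ.trans ρ.symm with hπdef
  have hπ : ∀ b, ρ (π b) = σ b := fun b => by simp [hπdef]
  have key := (Monovary.sum_mul_comp_perm_lt_sum_mul_iff (σ := π) hmv).mpr
  have hnot : ¬ Monovary κ ((fun b => ((ρ b : Fin m) : ℤ)) ∘ π) := by
    intro hmono
    -- then `x ↦ ρ (σ⁻¹ x)` is strictly monotone, hence the identity, hence `σ = ρ`
    have hsm : StrictMono fun x => ρ (σ.symm x) := by
      intro x y hxy
      have hne : σ.symm x ≠ σ.symm y := fun h => by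
        have := congrArg σ h; simp at this; exact absurd this (ne_of_lt hxy)
      have h1 : ((ρ (π (σ.symm x)) : Fin m) : ℤ) < ((ρ (π (σ.symm y)) : Fin m) : ℤ) := by
        rw [hπ, hπ]; simp only [Equiv.apply_symm_apply]; exact_mod_cast hxy
      have h2 : κ (σ.symm x) ≤ κ (σ.symm y) := hmono h1
      have h3 : κ (σ.symm x) < κ (σ.symm y) := lt_of_le_of_ne h2 (fun h => hne (hinj h))
      exact (hρ _ _).mpr h3
    apply hσ
    ext x
    have h := eq_self_of_strictMono hsm (σ x)
    simp only [Equiv.symm_apply_apply] at h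
    rw [h]
  have hlt := key hnot
  -- rewrite both sides
  have hl : ∑ i, κ i * ((fun b => ((ρ b : Fin m) : ℤ)) ∘ π) i = ∑ b, ((σ b : Fin m) : ℤ) * κ b := by
    refine Finset.sum_congr rfl fun b _ => ?_
    simp only [Function.comp, hπ b]; ring
  have hr : ∑ i, κ i * ((ρ i : Fin m) : ℤ) = ∑ b, ((ρ b : Fin m) : ℤ) * κ b :=
    Finset.sum_congr rfl fun b _ => by ring
  simp only [Function.comp] at hlt hl
  linarith [hlt, hl, hr]

/-! ## 3. The string law -/

/-- **THE STRING LAW (strict form).**  For every permutation `σ` of `Fin m`, every `0 ≤ K` and every `c`: if `ρ` ranks the keys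
`κ_b = 2c b + K ε_b` of `σ`'s own sign string `ε_b = [b ≤ σ b] − [σ b < b]` and `σ ≠ ρ`, then `P(σ) < P(ρ)` for the pencil
`P(τ) = Σ_b (K|τ b − b| − c(τ b − b)²)`: a permutation that is NOT the ranking of its own sign keys is strictly beaten by that ranking.
(`P(σ)` = its linearisation along `ε` = key functional at `σ` minus a constant < key functional at `ρ` minus the constant = linearisation of
`ρ` along `ε` ≤ `P(ρ)`.) [folklore] -/
theorem pencil_lt_pencil_selfRanking (K c : ℤ) (hK : 0 ≤ K) (σ ρ : Equiv.Perm (Fin m))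
    (hρ : ∀ b b', ρ b < ρ b' ↔
      2 * c * (b : ℤ) + K * (if (b : ℤ) ≤ ((σ b : Fin m) : ℤ) then (1 : ℤ) else -1) <
        2 * c * (b' : ℤ) + K * (if (b' : ℤ) ≤ ((σ b' : Fin m) : ℤ) then (1 : ℤ) else -1))
    (hne : σ ≠ ρ) :
    ∑ b, (K * |((σ b : Fin m) : ℤ) - b| - c * (((σ b : Fin m) : ℤ) - b) ^ 2) <
      ∑ b, (K * |((ρ b : Fin m) : ℤ) - b| - c * (((ρ b : Fin m) : ℤ) - b) ^ 2) := by
  set ε : Fin m → ℤ := fun b => if (b : ℤ) ≤ ((σ b : Fin m) : ℤ) then (1 : ℤ) else -1 with hεdef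
  have hε : ∀ b, ε b = 1 ∨ ε b = -1 := fun b => signString_mem σ b
  have hcomp : ∀ b, ε b * (((σ b : Fin m) : ℤ) - b) = |((σ b : Fin m) : ℤ) - b| := fun b => signString_compatible σ b
  rw [← linSum_eq_pencil_of_compatible K c ε σ hcomp]
  refine lt_of_lt_of_le ?_ (linSum_le_pencil K c hK ε hε ρ)
  rw [linSum_eq_keySum, linSum_eq_keySum]
  have := keySum_lt_of_ne_ranking (fun b => 2 * c * (b : ℤ) + K * ε b) ρ hρ σ hne
  linarith

/-- **THE STRING LAW (weak form)**: `P(σ) ≤ P(ρ)` for the ranking `ρ` of `σ`'s own sign keys. [folklore] -/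
theorem pencil_le_pencil_selfRanking (K c : ℤ) (hK : 0 ≤ K) (σ ρ : Equiv.Perm (Fin m))
    (hρ : ∀ b b', ρ b < ρ b' ↔
      2 * c * (b : ℤ) + K * (if (b : ℤ) ≤ ((σ b : Fin m) : ℤ) then (1 : ℤ) else -1) <
        2 * c * (b' : ℤ) + K * (if (b' : ℤ) ≤ ((σ b' : Fin m) : ℤ) then (1 : ℤ) else -1)) :
    ∑ b, (K * |((σ b : Fin m) : ℤ) - b| - c * (((σ b : Fin m) : ℤ) - b) ^ 2) ≤
      ∑ b, (K * |((ρ b : Fin m) : ℤ) - b| - c * (((ρ b : Fin m) : ℤ) - b) ^ 2) := by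
  rcases eq_or_ne σ ρ with rfl | hne
  · exact le_rfl
  · exact (pencil_lt_pencil_selfRanking K c hK σ ρ hρ hne).le

/-- **Every maximiser of the pencil is the ranking of its own sign keys** (given that such a ranking `ρ` exists, e.g. by
`exists_selfRanking`): if `P(σ') ≤ P(σ)` for all `σ'` then `σ = ρ`.  In particular the unique maximiser of `morph_member` is a self-ranking.
[folklore] -/
theorem selfRanking_of_isMax (K c : ℤ) (hK : 0 ≤ K) (σ ρ : Equiv.Perm (Fin m))
    (hρ : ∀ b b', ρ b < ρ b' ↔
      2 * c * (b : ℤ) + K * (if (b : ℤ) ≤ ((σ b : Fin m) : ℤ) then (1 : ℤ) else -1) <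
        2 * c * (b' : ℤ) + K * (if (b' : ℤ) ≤ ((σ b' : Fin m) : ℤ) then (1 : ℤ) else -1))
    (hmax : ∀ σ' : Equiv.Perm (Fin m),
      ∑ b, (K * |((σ' b : Fin m) : ℤ) - b| - c * (((σ' b : Fin m) : ℤ) - b) ^ 2) ≤
        ∑ b, (K * |((σ b : Fin m) : ℤ) - b| - c * (((σ b : Fin m) : ℤ) - b) ^ 2)) :
    σ = ρ := by
  by_contra hne
  exact absurd (hmax ρ) (not_le.mpr (pencil_lt_pencil_selfRanking K c hK σ ρ hρ hne))

/-! ## 4. Existence of the rankings: injectivity of the sign keys -/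

/-- **The keys of a string are injective** when `0 ≤ K`, `0 < c` and `c·t ≠ K` for every `0 < t < m` (two keys can only collide as
`2c b + K = 2c b' − K` with `b < b'`, i.e. `c (b' − b) = K`). [folklore] -/
theorem signKeys_injective (K c : ℤ) (hK : 0 ≤ K) (hc : 0 < c) (hKc : ∀ t : ℤ, 0 < t → t < m → c * t ≠ K)
    (ε : Fin m → ℤ) (hε : ∀ b, ε b = 1 ∨ ε b = -1) :
    Function.Injective fun b : Fin m => 2 * c * (b : ℤ) + K * ε b := by
  intro b b' h
  by_contra hne
  simp only at h
  have hb : ((b : ℕ) : ℤ) < m := by exact_mod_cast b.isLt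
  have hb' : ((b' : ℕ) : ℤ) < m := by exact_mod_cast b'.isLt
  have hbne : ((b : ℕ) : ℤ) ≠ ((b' : ℕ) : ℤ) := fun e => hne (Fin.ext (by exact_mod_cast e))
  -- a mixed collision `2c x + K = 2c y − K` with `x ≠ y` in `[0, m)` is impossible
  have mixed : ∀ x y : ℤ, 0 ≤ x → y < m → x ≠ y → 2 * c * x + K * 1 ≠ 2 * c * y + K * -1 := by
    intro x y hx hym hxy e
    have hK' : c * (y - x) = K := by linarith
    rcases le_or_gt (y - x) 0 with hle | hgt
    · have h0 : c * (y - x) = 0 := le_antisymm (by nlinarith) (by rw [hK']; exact hK)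
      rcases mul_eq_zero.mp h0 with h0 | h0
      · exact absurd h0 hc.ne'
      · exact hxy (by linarith)
    · exact hKc _ hgt (by linarith) hK'
  rcases hε b with h1 | h1 <;> rcases hε b' with h2 | h2 <;> rw [h1, h2] at h
  · exact hbne (by nlinarith)
  · exact mixed _ _ (by positivity) hb' hbne h
  · exact mixed _ _ (by positivity) hb hbne.symm h.symm
  · exact hbne (by nlinarith)

/-- The pencil of record: `c = 2`, `K` odd — the keys `4b + K ε_b` are injective with no size condition. [folklore] -/
theorem signKeys_injective_two_odd (K : ℤ) (hK : 0 ≤ K) (hodd : Odd K) (ε : Fin m → ℤ) (hε : ∀ b, ε b = 1 ∨ ε b = -1) :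
    Function.Injective fun b : Fin m => 2 * 2 * (b : ℤ) + K * ε b := by
  refine signKeys_injective K 2 hK (by norm_num) (fun t _ _ h => ?_) ε hε
  obtain ⟨k, hk⟩ := hodd
  omega

/-- **Self-rankings exist**: for `0 ≤ K`, `0 < c`, `c·t ≠ K` (`0 < t < m`), every `σ` has a (unique) ranking of its own sign keys. [folklore] -/
theorem exists_selfRanking (K c : ℤ) (hK : 0 ≤ K) (hc : 0 < c) (hKc : ∀ t : ℤ, 0 < t → t < m → c * t ≠ K)
    (σ : Equiv.Perm (Fin m)) :
    ∃ ρ : Equiv.Perm (Fin m), ∀ b b', ρ b < ρ b' ↔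
      2 * c * (b : ℤ) + K * (if (b : ℤ) ≤ ((σ b : Fin m) : ℤ) then (1 : ℤ) else -1) <
        2 * c * (b' : ℤ) + K * (if (b' : ℤ) ≤ ((σ b' : Fin m) : ℤ) then (1 : ℤ) else -1) :=
  exists_ranking _ (signKeys_injective K c hK hc hKc _ fun b => signString_mem σ b)

/-- **`max_{S_m} P = max_ε P(ρ_ε)`**, the useful half: every permutation is weakly beaten by the ranking of SOME `±1`-string (its own), so the
maximum of the pencil over the `m!` permutations is attained among the (at most `2^m`) string rankings. [folklore] -/
theorem exists_string_ranking_ge (K c : ℤ) (hK : 0 ≤ K) (hc : 0 < c) (hKc : ∀ t : ℤ, 0 < t → t < m → c * t ≠ K)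
    (σ : Equiv.Perm (Fin m)) :
    ∃ (ε : Fin m → ℤ) (ρ : Equiv.Perm (Fin m)), (∀ b, ε b = 1 ∨ ε b = -1) ∧
      (∀ b b', ρ b < ρ b' ↔ 2 * c * (b : ℤ) + K * ε b < 2 * c * (b' : ℤ) + K * ε b') ∧
      ∑ b, (K * |((σ b : Fin m) : ℤ) - b| - c * (((σ b : Fin m) : ℤ) - b) ^ 2) ≤
        ∑ b, (K * |((ρ b : Fin m) : ℤ) - b| - c * (((ρ b : Fin m) : ℤ) - b) ^ 2) := by
  obtain ⟨ρ, hρ⟩ := exists_selfRanking K c hK hc hKc σ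
  exact ⟨_, ρ, fun b => signString_mem σ b, hρ, pencil_le_pencil_selfRanking K c hK σ ρ hρ⟩

end Summit.ValiantsHypothesis.ValiantsHypothesis.Theorems.KPlusLogSqLaw.Toeplitz
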